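import Summits.HodgeConjecture.HodgeConjecture.Theorems.NikulinTwinTransportRealMultiplicationDivisorCorrespondences
import Literature.AlgebraicGeometry.HodgeTheory.GysinBaseChangeOfKunneth

/-!
# Route NikulinTwinTransport · `RealMultiplicationSqrtTwoAlgebraic` (stmt-HodgeConjecture-13679) —
# the fibre integral (FI) from the Künneth spanning property

Seat 3's reduction of the item (`realMultiplicationSqrtTwoAlgebraic_of_fibreIntegral`, file
`NikulinTwinTransportRealMultiplicationDivisorCorrespondences`) leaves, besides X =
`TwinSimilitudeAlgebraic` at the pair `(S, S)` and three named facts, ONE inline formal debt: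
FIBRE INTEGRATION (FI) — `pr_{1*}(pr_2^* p) = c · 1_S` with `c ≠ 0` for the generator `p` of
`H⁴(S(ℂ); ℂ)`. This file discharges (FI) from the SPANNING HALF OF THE KÜNNETH FORMULA in the top
degree of `(S ⊗ S)(ℂ)` (every class of `H⁸((S ⊗ S)(ℂ); ℂ)` is a `ℂ`-combination of cross products
`pr_1^* a ∪ pr_2^* w`; Hatcher Thm. 3.15, §3.B Thm. 3B.6), now that Poincaré duality for every
orientation family is a theorem of the tree (`OrientationFamily.hasPoincareDuality`):

* `exists_complexGysin_fst_map_snd_ne_zero` — for smooth projective `X`, `Y` and SOME top class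
  `w ∈ H^{2 dim Y}(Y(ℂ))`, `fst_*(snd^* w) ≠ 0` in `H⁰(X(ℂ))`: a top class `G₀` of `(X ⊗ Y)(ℂ)`
  pairs non-trivially with `[(X ⊗ Y)(ℂ)]` (universal coefficients over `ℂ`,
  `fundamentalClass_ne_zero`), `G₀` is a combination of cross products, of which only
  `fst^* a ∪ snd^* w` with `a`, `w` of top degree are non-zero, and
  `⟨fst^* a ∪ snd^* w, [X ⊗ Y]⟩ = ⟨a, fst(ℂ)_*(snd^* w ⌢ [X ⊗ Y])⟩ = ⟨a, fst_* snd^* w ⌢ [X]⟩`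
  (the two-factor form of the tree's `exists_complexGysin_map_ne_zero`);
* `complexGysin_fst_map_snd_ne_zero` — hence for EVERY `w ≠ 0` (`H^{2 dim Y}(Y(ℂ))` is a line,
  `exists_eq_smul_of_top`);
* `fibreIntegral_of_kunnethTop` — (FI): `fst_*(snd^* w) = c • 1`, `c ≠ 0` (`H⁰(X(ℂ)) = ℂ · 1`,
  `exists_eq_smul_one`);
* `realMultiplicationSqrtTwoAlgebraic_of_kunnethTop` — the route decl
  `RealMultiplicationSqrtTwoAlgebraic` from X, the named facts `Huybrechts_K3_marking_exists`,
  `Huybrechts_K3_hodgeTypes_H2`, `Grothendieck1969_supportedClasses_le_hodgeConiveau`, and Künneth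
  spanning of `H⁸((S ⊗ S)(ℂ))` for projective K3 surfaces `S` (the generator `p` is non-zero
  because the marking's generator `p₀ ≠ 0` is an integral multiple of it);
  `realMultiplicationSqrtTwoAlgebraic_of_kunneth` — the same from the uniform Künneth spanning
  hypothesis `hK` of `Literature.AlgebraicGeometry.HodgeTheory.gysin_baseChange_of_kunneth`;
* `realMultiplicationGlue_of_kunneth`, `assembly_of_squareGlue_of_kunneth` — items 13681 / 13942
  likewise, with (FI) replaced by Künneth spanning.

So the item is now: X + four published facts (three named in the tree, plus Künneth spanning),
no inline debt. Not here: X (open sub-case of the Hodge conjecture) and the Künneth formula itself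
(Eilenberg–Zilber for the tree's singular cochains; absent).
Prover seat prover-pitem-stmt-HodgeConjecture-13679-0.

## References

* [HatcherAT2002] A. Hatcher, Algebraic Topology, CUP 2002, §3.1 Thm. 3.2, §3.2 Thm. 3.15,
  §3.B Thm. 3B.6, §3.3 Thm. 3.26, Thm. 3.30.
* [FultonYoungTableaux1997] W. Fulton, Young Tableaux, CUP 1997, App. B §B.1 (3)–(6).
* [Varesco2023] M. Varesco, Math. Z. 305 (2023), Thm. 2.1, Rem. 2.2.
-/

noncomputable section

namespace Summit.HodgeConjecture.HodgeConjecture.Theorems.NikulinTwinTransport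

open scoped Manifold
open CategoryTheory MonoidalCategory SemiCartesianMonoidalCategory
open Literature.AlgebraicGeometry.Motives Literature.AlgebraicGeometry.HodgeTheory
open Literature.AlgebraicGeometry.Surfaces Literature.Geometry.Kaehler
open Literature.AlgebraicTopology.SingularHomology

section TwoFactors

variable {l m : ℕ} {X Y : SchemeOver ℂ}

/-- **For some top class `w ∈ H^{2 dim Y}(Y(ℂ))`, `fst_*(snd^* w) ≠ 0` in `H⁰(X(ℂ))`** (`X`, `Y`
smooth projective, `fst, snd` the projections of `X ⊗ Y`), GRANTED the Künneth spanning property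
in the top degree of `(X ⊗ Y)(ℂ)`: a top class `G₀` pairs non-trivially with `[(X ⊗ Y)(ℂ)] ≠ 0`
(universal coefficients over `ℂ`); it is a combination of cross products `fst^* a ∪ snd^* w`, which
vanish unless `a`, `w` are of top degree, and then
`⟨fst^* a ∪ snd^* w, [X ⊗ Y]⟩ = ⟨a, fst(ℂ)_*(snd^* w ⌢ [X ⊗ Y])⟩ = ⟨a, fst_*(snd^* w) ⌢ [X]⟩`.
Two-factor form of `Literature.AlgebraicGeometry.HodgeTheory.exists_complexGysin_map_ne_zero`.
[cite: HatcherAT2002, §3.2 Thm. 3.15 and §3.1 Thm. 3.2] [cite: FultonYoungTableaux1997, Appendix B §B.1 (5)] -/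
theorem exists_complexGysin_fst_map_snd_ne_zero (μ : OrientationFamily)
    (hX : IsSmoothProjective l X) (hY : IsSmoothProjective m Y)
    (hKT : ∀ z : complexBetti (X ⊗ Y) (2 * (l + m)), z ∈ Submodule.span ℂ
      {v | ∃ (i j : ℕ) (h : i + j = 2 * (l + m)) (a : complexBetti X i) (w : complexBetti Y j),
        v = cupProduct h (complexBetti.map (fst X Y) i a) (complexBetti.map (snd X Y) j w)}) :
    ∃ w : complexBetti Y (2 * m),
      complexGysin μ (IsSmoothProjective.tensor_holds hX hY) hX (fst X Y)
        (show 2 * m + 2 * l = 0 + 2 * (l + m) by omega)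
        (complexBetti.map (snd X Y) (2 * m) w) ≠ 0 := by
  have hμ : μ.HasPoincareDuality := OrientationFamily.hasPoincareDuality μ
  have hT := IsSmoothProjective.tensor_holds hX hY
  letI := hT.chartedSpace
  haveI := ComplexPoints.compactSpace_of_isSmoothProjective hT
  haveI := ComplexPoints.t2Space_of_isSmoothProjective hT
  haveI := connectedSpace_complexPoints hT
  -- a top-degree class of `(X ⊗ Y)(ℂ)` pairing non-trivially with the fundamental class
  set κ := kroneckerPairing ℂ ℂ (ComplexPoints (X ⊗ Y)) (2 * (l + m)) with hκ
  have hne : (μ hT).fundamentalClass ≠ 0 := fundamentalClass_ne_zero (μ hT)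
  obtain ⟨φ, hφ⟩ : ∃ φ : Module.Dual ℂ (singularHomology ℂ ℂ (ComplexPoints (X ⊗ Y)) (2 * (l + m))),
      φ (μ hT).fundamentalClass ≠ 0 := by
    by_contra h
    push Not at h
    exact hne ((Module.forall_dual_apply_eq_zero_iff ℂ _).1 h)
  obtain ⟨G₀, hG₀⟩ := kroneckerPairing_surjective ℂ (ComplexPoints (X ⊗ Y)) (2 * (l + m)) φ
  have hG₀ne : κ G₀ (μ hT).fundamentalClass ≠ 0 := by rw [hκ, hG₀]; exact hφ
  by_contra hall
  push Not at hall
  apply hG₀ne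
  -- the pairing with `[X ⊗ Y]` kills every cross product `fst^* a ∪ snd^* w` of top bidegree
  have key : ∀ (a : complexBetti X (2 * l)) (w : complexBetti Y (2 * m)),
      κ (cupProduct (show 2 * l + 2 * m = 2 * (l + m) by omega)
        (complexBetti.map (fst X Y) (2 * l) a) (complexBetti.map (snd X Y) (2 * m) w))
        (μ hT).fundamentalClass = 0 := by
    intro a w
    have hsign : ((-1 : ℂ) ^ (2 * l * (2 * m))) = 1 := Even.neg_one_pow ⟨l * (2 * m), by ring⟩
    rw [cupProduct_gradedComm_holds ℂ _ _ (show 2 * m + 2 * l = 2 * (l + m) by omega), hsign,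
      one_smul, hκ, kroneckerPairing_cupProduct]
    change kroneckerPairing ℂ ℂ _ _ (singularCohomology.map ℂ ℂ
      (AlgPoints.mapContinuous (L := ℂ) (fst X Y)) _ a) _ = 0
    rw [kroneckerPairing_map, ← capProduct_complexGysin hμ hT hX (fst X Y)
      (show 2 * m + 2 * l = 0 + 2 * (l + m) by omega) _ (Nat.zero_add _), hall w, map_zero,
      LinearMap.zero_apply, map_zero]
  -- hence (Künneth spanning) it kills everything
  have hle : Submodule.span ℂ {v | ∃ (i j : ℕ) (h : i + j = 2 * (l + m)) (a : complexBetti X i)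
        (w : complexBetti Y j),
        v = cupProduct h (complexBetti.map (fst X Y) i a) (complexBetti.map (snd X Y) j w)} ≤
      LinearMap.ker (κ.flip (μ hT).fundamentalClass) := by
    refine Submodule.span_le.2 ?_
    rintro _ ⟨i, j, h, a, w, rfl⟩
    rw [SetLike.mem_coe, LinearMap.mem_ker, LinearMap.flip_apply]
    rcases lt_trichotomy (2 * l) i with hi | hi | hi
    · haveI := subsingleton_complexBetti hX hi
      rw [Subsingleton.elim a 0, map_zero, map_zero, LinearMap.zero_apply, map_zero,
        LinearMap.zero_apply]
    swap
    · haveI := subsingleton_complexBetti hY (show 2 * m < j by omega)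
      rw [Subsingleton.elim w 0, map_zero, map_zero, map_zero, LinearMap.zero_apply]
    subst hi
    obtain rfl : j = 2 * m := by omega
    exact key a w
  exact hle (hKT G₀)

/-- **`fst_*(snd^* w) ≠ 0` in `H⁰(X(ℂ))` for EVERY non-zero top class `w ∈ H^{2 dim Y}(Y(ℂ))`**,
granted Künneth spanning in the top degree of `(X ⊗ Y)(ℂ)`: `H^{2 dim Y}(Y(ℂ); ℂ)` is a line
(`exists_eq_smul_of_top`), and the fibre integral does not vanish identically on it
(`exists_complexGysin_fst_map_snd_ne_zero`).
[cite: HatcherAT2002, §3.2 Thm. 3.15 and §3.3 Thm. 3.26] [cite: FultonYoungTableaux1997, Appendix B §B.1 (5)] -/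
theorem complexGysin_fst_map_snd_ne_zero (μ : OrientationFamily)
    (hX : IsSmoothProjective l X) (hY : IsSmoothProjective m Y)
    (hKT : ∀ z : complexBetti (X ⊗ Y) (2 * (l + m)), z ∈ Submodule.span ℂ
      {v | ∃ (i j : ℕ) (h : i + j = 2 * (l + m)) (a : complexBetti X i) (w : complexBetti Y j),
        v = cupProduct h (complexBetti.map (fst X Y) i a) (complexBetti.map (snd X Y) j w)})
    {w : complexBetti Y (2 * m)} (hw : w ≠ 0) :
    complexGysin μ (IsSmoothProjective.tensor_holds hX hY) hX (fst X Y)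
        (show 2 * m + 2 * l = 0 + 2 * (l + m) by omega)
        (complexBetti.map (snd X Y) (2 * m) w) ≠ 0 := by
  obtain ⟨w₁, hw₁⟩ := exists_complexGysin_fst_map_snd_ne_zero μ hX hY hKT
  obtain ⟨t, rfl⟩ := exists_eq_smul_of_top μ hY hw w₁
  intro h
  apply hw₁
  rw [map_smul, map_smul, h, smul_zero]

/-- **Fibre integration (FI) from Künneth spanning**: for smooth projective `X`, `Y` and a non-zero
top class `w ∈ H^{2 dim Y}(Y(ℂ))`, `fst_*(snd^* w) = c • 1` in `H⁰(X(ℂ))` with `c ≠ 0`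
(`H⁰(X(ℂ); ℂ) = ℂ · 1` for the connected `X(ℂ)`, `exists_eq_smul_one`; non-vanishing
`complexGysin_fst_map_snd_ne_zero`). For the complex orientations and `w` the class of a point,
`c = 1` (Fulton, App. B (4)–(6)); here `c` is whatever the orientation family gives.
[cite: FultonYoungTableaux1997, Appendix B §B.1 (4)–(6)] [cite: HatcherAT2002, §3.2 Thm. 3.15] -/
theorem fibreIntegral_of_kunnethTop (μ : OrientationFamily)
    (hX : IsSmoothProjective l X) (hY : IsSmoothProjective m Y)
    (hKT : ∀ z : complexBetti (X ⊗ Y) (2 * (l + m)), z ∈ Submodule.span ℂ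
      {v | ∃ (i j : ℕ) (h : i + j = 2 * (l + m)) (a : complexBetti X i) (w : complexBetti Y j),
        v = cupProduct h (complexBetti.map (fst X Y) i a) (complexBetti.map (snd X Y) j w)})
    {w : complexBetti Y (2 * m)} (hw : w ≠ 0) :
    ∃ c : ℂ, c ≠ 0 ∧
      complexGysin μ (IsSmoothProjective.tensor_holds hX hY) hX (fst X Y)
          (show 2 * m + 2 * l = 0 + 2 * (l + m) by omega)
          (complexBetti.map (snd X Y) (2 * m) w) =
        c • singularCohomology.one ℂ (ComplexPoints X) := by
  obtain ⟨c, hc⟩ := exists_eq_smul_one μ hX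
    (complexGysin μ (IsSmoothProjective.tensor_holds hX hY) hX (fst X Y)
      (show 2 * m + 2 * l = 0 + 2 * (l + m) by omega) (complexBetti.map (snd X Y) (2 * m) w))
  refine ⟨c, ?_, hc⟩
  rintro rfl
  exact complexGysin_fst_map_snd_ne_zero μ hX hY hKT hw (by rw [hc, zero_smul])

end TwoFactors

/-! ### The item modulo X, three named facts and Künneth spanning -/

/-- **Real multiplication by `√2` on a projective K3 surface is algebraic, granted X = Sim₂(K3) at
the pair `(S, S)`, the three named K3/Hodge facts, and Künneth spanning of `H⁸((S ⊗ S)(ℂ); ℂ)`**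
(`hKT`: every class of top degree on `(S ⊗ S)(ℂ)` is a `ℂ`-combination of cross products
`pr_1^* a ∪ pr_2^* w`, for every projective K3 surface `S`; Hatcher Thm. 3.15 with §3.B
Thm. 3B.6). Seat 3's `realMultiplicationSqrtTwoAlgebraic_of_fibreIntegral` with its hypothesis
(FI) discharged by `fibreIntegral_of_kunnethTop`; the generator `p` of the integral classes of
`H⁴(S(ℂ))` is non-zero because the marking's generator `p₀ ≠ 0` (`Huybrechts_K3_marking_exists`)
is an integral multiple of it. [cite: Varesco2023, Thm. 2.1 and Rem. 2.2]
[cite: HatcherAT2002, §3.2 Thm. 3.15] -/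
theorem realMultiplicationSqrtTwoAlgebraic_of_kunnethTop
    (hX : Theses.NikulinTwinTransport.TwinSimilitudeAlgebraic)
    (hmark : Huybrechts_K3_marking_exists) (hHT : Huybrechts_K3_hodgeTypes_H2)
    (hN11 : ∀ (S : SchemeOver ℂ), IsK3Surface S →
      ∀ d ∈ algebraicClasses S 1, IsOfHodgeType 2 S (2 * 1) 1 1 d)
    (hKT : ∀ ⦃S : SchemeOver ℂ⦄, IsK3Surface S →
      ∀ z : complexBetti (S ⊗ S) (2 * (2 + 2)), z ∈ Submodule.span ℂ
        {v | ∃ (i j : ℕ) (h : i + j = 2 * (2 + 2)) (a : complexBetti S i) (w : complexBetti S j),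
          v = cupProduct h (complexBetti.map (fst S S) i a) (complexBetti.map (snd S S) j w)}) :
    Theses.NikulinTwinTransport.RealMultiplicationSqrtTwoAlgebraic := by
  refine realMultiplicationSqrtTwoAlgebraic_of_fibreIntegral hX hmark hHT hN11 ?_
  intro μ _ S hS p hp
  -- the generator `p` is non-zero: the marking's generator `p₀ ≠ 0` is an integral multiple of it
  obtain ⟨-, p₀, -, hp₀, ⟨hp₀int, -⟩, -⟩ := hmark S hS
  have hp0 : p ≠ 0 := by
    obtain ⟨n, hn⟩ := hp.2 p₀ hp₀int
    rintro rfl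
    exact hp₀ (by rw [hn, smul_zero])
  exact fibreIntegral_of_kunnethTop μ hS.1 hS.1 (hKT hS) hp0

/-- **The same, from the uniform Künneth spanning hypothesis** `hK` of
`Literature.AlgebraicGeometry.HodgeTheory.gysin_baseChange_of_kunneth` (every class on the complex
points of a product of two smooth projective varieties is a `ℂ`-combination of cross products, all
degrees): **real multiplication by `√2` is algebraic granted X, the three named facts and the
Künneth spanning property** — the item with NO inline formal debt left.
[cite: Varesco2023, Thm. 2.1 and Rem. 2.2] [cite: HatcherAT2002, §3.2 Thm. 3.15] -/
theorem realMultiplicationSqrtTwoAlgebraic_of_kunneth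
    (hX : Theses.NikulinTwinTransport.TwinSimilitudeAlgebraic)
    (hmark : Huybrechts_K3_marking_exists) (hHT : Huybrechts_K3_hodgeTypes_H2)
    (hG : Grothendieck1969_supportedClasses_le_hodgeConiveau)
    (hK : ∀ ⦃m' n' : ℕ⦄ ⦃Y' Z' : SchemeOver ℂ⦄, IsSmoothProjective m' Y' → IsSmoothProjective n' Z' →
      ∀ (k : ℕ) (z : complexBetti (Y' ⊗ Z') k), z ∈ Submodule.span ℂ
        {v | ∃ (i j : ℕ) (h : i + j = k) (b : complexBetti Y' i) (w : complexBetti Z' j),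
          v = cupProduct h (complexBetti.map (fst Y' Z') i b) (complexBetti.map (snd Y' Z') j w)}) :
    Theses.NikulinTwinTransport.RealMultiplicationSqrtTwoAlgebraic :=
  realMultiplicationSqrtTwoAlgebraic_of_kunnethTop hX hmark hHT
    (fun _ hS _ hd => isOfHodgeType_oneOne_of_mem_algebraicClasses hG hS hd)
    (fun _ hS => hK hS.1 hS.1 (2 * (2 + 2)))

/-- **The glue item `RealMultiplicationGlue` (stmt-HodgeConjecture-13681) from the three named
facts and the Künneth spanning property alone** (seat 3's `realMultiplicationGlue_of_fibreIntegral`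
with (FI) discharged): no Buskin, no universal twin, no Lefschetz `(1,1)`, no inline debt.
[cite: Varesco2023, Thm. 2.1 and Rem. 2.2] [cite: HatcherAT2002, §3.2 Thm. 3.15] -/
theorem realMultiplicationGlue_of_kunneth
    (hmark : Huybrechts_K3_marking_exists) (hHT : Huybrechts_K3_hodgeTypes_H2)
    (hG : Grothendieck1969_supportedClasses_le_hodgeConiveau)
    (hK : ∀ ⦃m' n' : ℕ⦄ ⦃Y' Z' : SchemeOver ℂ⦄, IsSmoothProjective m' Y' → IsSmoothProjective n' Z' →
      ∀ (k : ℕ) (z : complexBetti (Y' ⊗ Z') k), z ∈ Submodule.span ℂ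
        {v | ∃ (i j : ℕ) (h : i + j = k) (b : complexBetti Y' i) (w : complexBetti Z' j),
          v = cupProduct h (complexBetti.map (fst Y' Z') i b) (complexBetti.map (snd Y' Z') j w)}) :
    Theses.NikulinTwinTransport.RealMultiplicationGlue :=
  fun hX _ _ _ => realMultiplicationSqrtTwoAlgebraic_of_kunneth hX hmark hHT hG hK

/-- **The frame item `Assembly` (stmt-HodgeConjecture-13942) from `SquareGlue`, the three named
facts and the Künneth spanning property** (seat 3's `assembly_of_squareGlue_of_fibreIntegral` with
(FI) discharged). [cite: Varesco2023, Thm. 2.1 and Rem. 2.2] [cite: HatcherAT2002, §3.2 Thm. 3.15] -/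
theorem assembly_of_squareGlue_of_kunneth
    (hSq : Theses.NikulinTwinTransport.SquareGlue)
    (hmark : Huybrechts_K3_marking_exists) (hHT : Huybrechts_K3_hodgeTypes_H2)
    (hG : Grothendieck1969_supportedClasses_le_hodgeConiveau)
    (hK : ∀ ⦃m' n' : ℕ⦄ ⦃Y' Z' : SchemeOver ℂ⦄, IsSmoothProjective m' Y' → IsSmoothProjective n' Z' →
      ∀ (k : ℕ) (z : complexBetti (Y' ⊗ Z') k), z ∈ Submodule.span ℂ
        {v | ∃ (i j : ℕ) (h : i + j = k) (b : complexBetti Y' i) (w : complexBetti Z' j),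
          v = cupProduct h (complexBetti.map (fst Y' Z') i b) (complexBetti.map (snd Y' Z') j w)}) :
    Theses.NikulinTwinTransport.Assembly :=
  fun hX _ _ h₁ h₇ => h₇ (hSq (realMultiplicationSqrtTwoAlgebraic_of_kunneth hX hmark hHT hG hK) h₁)

end Summit.HodgeConjecture.HodgeConjecture.Theorems.NikulinTwinTransport

end
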